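import Mathlib
import Summits.QuantumFields.YangMills.Theorems.TransverseWardBLGinibreInfraredBound
import Literature.MathematicalPhysics.QuantumFieldTheory.U1GinibreComparison
import Summits.QuantumFields.YangMills.Theses.TransverseWardBL
import HarnessLib

/-!
# `TransverseWardBL.InfraredBound` (item stmt-QuantumFields-23102): the `δ = 0` infrared bound for Wilson `U(1)₄`

Route `TransverseWardBL` of `QuantumFields/YangMills` (LINE g9-C of the ideator seat ym-idea-4, card
«spectral / trace methods»; an abelian line onto the leaf `Theorems.U1HelicityGapTorusD4` — NOT a rung
toward `YangMills`; nothing here bears on the Yang–Mills mass gap), support item `InfraredBound`: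
for every `β > 0`, every torus `(ℤ/(M+1))⁴` and every real plaquette 2-form `h`,

  `β · ⟨(∑_p h_p sin θ_p)²⟩_{Λ_{M+1}, β} ≤ ∑_p h_p²`

(Gaussian domination / infrared bound of Fröhlich–Simon–Spencer type for the periodic Wilson `U(1)`
theory; A. Guth, Phys. Rev. D 21 (1980) 2291; J. Fröhlich–T. Spencer, Comm. Math. Phys. 83 (1982) 411).

Proof: the torus Wilson state is a Ginibre expectation with constant couplings `β` on the configuration
group `U(1)^E` (inlined; cf. the tree's `wilsonExpectation_u1_eq_ginibreExpect`); the general second-order Gaussian-domination inequality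
`⟨(∑ Jₐ hₐ Im χₐ)²⟩_J ≤ ⟨∑ Jₐ hₐ² Re χₐ⟩_J` (`ginibreExpect_sq_sum_imChar_le`, file
`TransverseWardBLGinibreInfraredBound`, from `Z(h) ≤ Z(0)` in `TransverseWardBLGaussianDomination` —
positive kernels, no reflection positivity, hence no parity restriction on `M`) with `Jₐ = β` reads
`β² ⟨(∑ h_p sin θ_p)²⟩ ≤ β ∑ h_p² ⟨cos θ_p⟩ ≤ β |h|²`; divide by `β > 0`.
-/

noncomputable section

open MeasureTheory Filter Finset
open scoped Topology BigOperators
open Literature.Probability.LatticeModels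

namespace Summit.QuantumFields.YangMills.Theorems.TransverseWardBL

/-! ### Closer: the Wilson `U(1)₄` torus -/

section U1

open Literature.MathematicalPhysics.QuantumFieldTheory Literature.MathematicalPhysics.QuantumLattice

variable {Ω : Type*} [CommGroup Ω] [TopologicalSpace Ω] [CompactSpace Ω] [MeasurableSpace Ω]
  [BorelSpace Ω] {ι : Type*} [Fintype ι]

omit [CompactSpace Ω] [BorelSpace Ω] in
/-- Linearity of the Gibbs expectation in a scalar factor. [folklore] -/
theorem ginibreExpect_const_mul (μ : Measure Ω) (χ : ι → Ω →ₜ* Circle) (J : ι → ℝ) (c : ℝ)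
    (F : Ω → ℝ) : ginibreExpect μ χ J (fun θ => c * F θ) = c * ginibreExpect μ χ J F := by
  unfold ginibreExpect
  simp_rw [mul_assoc]
  rw [integral_const_mul, mul_div_assoc]

/-- Monotonicity of the Gibbs expectation against a constant: `F ≤ c` pointwise (`F` continuous)
gives `⟨F⟩_J ≤ c`. [folklore] -/
theorem ginibreExpect_le_const (μ : Measure Ω) [IsFiniteMeasure μ] [NeZero μ]
    (χ : ι → Ω →ₜ* Circle) (J : ι → ℝ) {F : Ω → ℝ} (hF : Continuous F) {c : ℝ}
    (hle : ∀ θ, F θ ≤ c) : ginibreExpect μ χ J F ≤ c := by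
  unfold ginibreExpect
  have hZ : 0 < ∫ θ, ginibreWeight χ J θ ∂μ :=
    integral_exp_pos (integrable_of_continuous_compactSpace μ (continuous_ginibreWeight χ J))
  rw [div_le_iff₀ hZ, ← integral_const_mul]
  refine integral_mono (integrable_of_continuous_compactSpace μ (hF.mul (continuous_ginibreWeight χ J)))
    (integrable_of_continuous_compactSpace μ (continuous_const.mul (continuous_ginibreWeight χ J)))
    fun θ => ?_
  exact mul_le_mul_of_nonneg_right (hle θ) (Real.exp_pos _).le

/-- **`InfraredBound` holds** (item stmt-QuantumFields-23102 of route `TransverseWardBL`): for every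
`β > 0`, every torus `(ℤ/(M+1))⁴` and every real plaquette 2-form `h`,
`β ⟨(∑_p h_p sin θ_p)²⟩_{β,M} ≤ ∑_p h_p²` — the `δ = 0` infrared (Gaussian-domination) bound for
Wilson `U(1)₄`, from `ginibreExpect_sq_sum_imChar_le` with `Jₐ = β` and `⟨cos θ_p⟩ ≤ 1`. [folklore] -/
theorem infraredBound_proof : Summit.QuantumFields.YangMills.Theses.TransverseWardBL.InfraredBound := by
  intro β hβ M h
  show β * wilsonExpectation (L := M + 1) u1Rep β (fun U : GaugeConfig 4 (M + 1) Circle =>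
      (∑ p : Plaquette 4 (M + 1), h p *
        ((plaquetteHolonomy U p.1 p.2.1.1 p.2.1.2 : Circle) : ℂ).im) ^ 2) ≤ ∑ p, (h p) ^ 2
  set μ : Measure (GaugeConfig 4 (M + 1) Circle) :=
    Measure.pi fun _ : Edge 4 (M + 1) => haarProbability Circle with hμ
  -- the torus Wilson state is the Ginibre state with constant couplings `β`
  -- (as `wilsonExpectation_u1_eq_ginibreExpect` / `TransverseWardBLDefect.wilsonExpectation_u1_eq_ginibreExpect_fun`)
  have hgin : ∀ F : GaugeConfig 4 (M + 1) Circle → ℝ, wilsonExpectation (L := M + 1) u1Rep β F =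
      ginibreExpect μ (u1TorusChars M) (fun _ => β) F := fun F => by
    rw [wilsonExpectation_eq_div_integral u1Rep continuous_u1Rep, ginibreExpect]
    simp_rw [exp_neg_mul_wilsonAction_u1]
    set c := Real.exp (-β * Fintype.card (Plaquette 4 (M + 1)))
    have hc : c ≠ 0 := (Real.exp_pos _).ne'
    simp_rw [mul_left_comm _ c, integral_const_mul]
    rw [mul_div_mul_left _ _ hc]
  rw [hgin]
  have hJ : ∀ _p : Plaquette 4 (M + 1), 0 ≤ β := fun _ => hβ.le
  have key := ginibreExpect_sq_sum_imChar_le μ (u1TorusChars M) hJ h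
  -- left-hand side: `(∑ β h_p Im χ_p)² = β² (∑ h_p sin θ_p)²`
  have hL : (fun θ : GaugeConfig 4 (M + 1) Circle =>
      (∑ p, β * h p * imChar (u1TorusChars M p) θ) ^ 2) = fun U => β ^ 2 *
        (∑ p : Plaquette 4 (M + 1), h p *
          ((plaquetteHolonomy U p.1 p.2.1.1 p.2.1.2 : Circle) : ℂ).im) ^ 2 := by
    funext U
    have : (∑ p, β * h p * imChar (u1TorusChars M p) U) = β * ∑ p : Plaquette 4 (M + 1), h p *
        ((plaquetteHolonomy U p.1 p.2.1.1 p.2.1.2 : Circle) : ℂ).im := by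
      rw [Finset.mul_sum]
      refine Finset.sum_congr rfl fun p _ => ?_
      simp only [imChar, u1TorusChars, u1PlaqChar_apply, mul_assoc]
    rw [this, mul_pow]
  -- right-hand side: `∑ β h_p² Re χ_p ≤ β ∑ h_p²`
  have hR : ginibreExpect μ (u1TorusChars M) (fun _ => β)
      (fun θ => ∑ p, β * (h p) ^ 2 * reChar (u1TorusChars M p) θ) ≤ β * ∑ p, (h p) ^ 2 := by
    refine ginibreExpect_le_const μ _ _
      (continuous_finsetSum _ fun _ _ => continuous_const.mul (continuous_reChar _)) fun θ => ?_
    rw [Finset.mul_sum]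
    refine Finset.sum_le_sum fun p _ => ?_
    show β * (h p) ^ 2 * reChar (u1TorusChars M p) θ ≤ β * (h p) ^ 2
    have h1 : reChar (u1TorusChars M p) θ ≤ 1 := (le_abs_self _).trans (abs_reChar_le_one _ _)
    have h2 : 0 ≤ β * (h p) ^ 2 := mul_nonneg hβ.le (sq_nonneg _)
    nlinarith
  rw [hL, ginibreExpect_const_mul] at key
  have h3 : β * (β * ginibreExpect μ (u1TorusChars M) (fun _ => β) (fun U =>
      (∑ p : Plaquette 4 (M + 1), h p *
        ((plaquetteHolonomy U p.1 p.2.1.1 p.2.1.2 : Circle) : ℂ).im) ^ 2)) ≤ β * ∑ p, (h p) ^ 2 := by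
    have := key.trans hR
    rw [sq, mul_assoc] at this
    exact this
  exact le_of_mul_le_mul_left h3 hβ

end U1

end Summit.QuantumFields.YangMills.Theorems.TransverseWardBL

end
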